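import Mathlib
import Literature.MathematicalPhysics.QuantumFieldTheory.BalabanImbrieJaffe1984to88.BIJ85Eq715ConfigSymbols
import Literature.MathematicalPhysics.QuantumFieldTheory.BalabanImbrieJaffe1984to88.BIJ85Eq7111EdgeAdjoint

/-!
# `BalabanImbrieJaffe1984to88.BIJ85Eq7112FibreEnergy` — T. Bałaban, J. Imbrie, A. Jaffe, *Renormalization of the Higgs model:
minimizers, propagators and the stability of mean field theory*, Commun. Math. Phys. **97** (1985) 299–329 [BalabanImbrieJaffe1985]:
Sect. 4.2 p. 310 (4.2.1) with Sect. 7.1 pp. 321–322 (7.1.2)/(7.1.11)/(7.1.12) — **THE FIBRE DECOMPOSITION of the variational problem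
defining σ_k**: on the tori, for the CONCRETE operators `∂ = ∂^η` (η-lattice curl), `Q^{e*}_k` (`BIJ85Eq7111EdgeAdjoint.edgeAdjC`) and
`Q_k` ([6I] (1.18), pub-balaban `B5Block118.QvOp`), the energy of (4.2.1) *"exp(−½⟨f,σ_kf⟩) = Z^{−1}∫𝒟A δ(Q_kA)δ_{k,Ax}(A) exp(−½‖∂A −
Q^{e*}_kf‖²)"* SPLITS OVER THE UNIT MOMENTA: `‖∂A − Q^{e*}_kf‖²_η = Σ_{p′} E_{p′}((Â(p′+l))_l, f̂(p′))` with an explicit FIBRE ENERGY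
`E_{p′}(α, φ) = Σ_l Σ_{λκ} |∂_λ(p′+l)α_l(κ) − ∂_κ(p′+l)α_l(λ) − w̄_{λκ}(p′+l)φ_{λκ}|²` (the (7.1.11) weight `w`), the constraint `Q_kA = 0`
SPLITS into `Σ_l u(p′+l)v_μ(p′+l)α_l(μ) = 0` per `p′` ([6I] (1.61)), and `‖f‖² = Σ_{p′}|f̂(p′)|²` — so a UNIFORM FIBREWISE bound
`c|φ|² ≤ E_{p′}(α,φ)` on constrained `α` (seat p10's `BIJ85Eq7113Derivation*`, (7.1.13)–(7.1.16)/Prop. 7.1.2) gives Theorem 7.1.1 in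
configuration space in the variational form `c‖f‖² ≤ ‖∂A − Q^{e*}_kf‖²_η ∀ Q_kA = 0` (`thm711_config_of_fibre`) — file 16 of the (7.1.2)
cluster

statement-level skeleton of published theorems with citation tags; proofs where landed; nothing here is a claim about
the Yang–Mills mass gap

PDF held: `paper:balaban1985-cmp97-bij-higgs-minimizers` (journal page = PDF page + 298).  Text read as images: PDF p. 12 (journal 310;
`run/shared/lean/pub/pub-balaban/t4/b2b-balaban-t4-lit2/renders/bij1985/1985-cmp97-bij-higgs-minimizers-p012-x2.png`), PDF pp. 23–25.

CITATION HEADER (lean-in-tree rule).  Part of the lit-balaban TYPED SKELETON (HOME `run/shared/lean/pub/lit-balaban/`); WHAT IS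
REPRODUCED: the passage from the configuration-space definition (4.2.1)/(7.1.12) of σ_k (rows **C1.Eq4.2.1-4.2.2**, **C1.Eq7.1.2-7.1.12**;
p. 322: *"The basic object we wish to study is σ_k, defined in (4.2.2), σ_k = Q^e_k(I − ∂G_{k,Ax}∂^*)Q^{e*}_k. (7.1.12) … Starting from
this expression, one can derive the following formulas for σ_k(p) by straightforward, algebraic manipulation"*) to the FIBREWISE
variational problems behind (7.1.13)–(7.1.16), `HOME/lit-balaban-r15/ROWS-C1.md` (owner r15, referee ref-5; the fibrewise algebra
itself is seat p10's `BIJ85Eq7113Derivation`, `…Part2–4`).  TYPED READING: η-torus `Tor (fine n M)`, unit torus `Tor M`, `F⊗1 = dftC`,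
cosets `p = p′ + l ↔ pOf n M (k, q)`; η-bond fields `A : Tor (fine n M) × Fin d → ℂ`, unit plaquette fields `f : Tor M × (Fin d × Fin d) →
ℂ` (ordered orientation pairs, as in gen-4's `curlC`); `∂^η = n·curlC (fine n M)` (η^{−1} = n), `‖g‖²_η = η^dΣ|g|²` ((2.20)), `Q^{e*}_k =
edgeAdjC` ((2.22)_k), `Q_k = B5Block118.QvOp`; the symbols `∂_λ(p′+l) = B5Prop11Fiber.dSym n k p′ λ`, `u`, `v_μ` = `B5Prop11Fiber.uSym/vSym`,
`w = BIJ85Eq7111EdgeAverage.edgeW`; `c = cQ n M = n^{−d/2}` the ratio of the unitary DFT normalisations — the fibre variables are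
`α_l = c·Â(p′+l)` ([6I]'s weighted transform (1.29)).
WHAT IS KERNEL-CHECKED (zero `sorry`, standard axioms): momentum representations `dftC_mulVec_TI` (fine-TI operators act by their
symbol), **`dftC_mulVec_conjTranspose_cross`** (`(F_η⊗1)(Tᴴg)(p) = c·σ_T(p)ᴴ ĝ(p mod 2π)` — the adjoint of an averaging operator feeds
each `p′+l` from `p′` only), `chi_pOf_unitVec`, `natCast_mul_dOne_pOf` (`n·(e^{iηp_λ} − 1) = ∂_λ(p′+l)`), **`dft_curl_fine`** and
**`dft_edgeAdjC`** (`(Q^{e*}_kf)^(p′+l)_{λκ} = c^{−1}·w̄_{λκ}(p′+l)f̂_{λκ}(p′)`); the coset Plancherel `sum_norm_sq_eq_sum_cosets`; the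
definitions `fibreEnergy`, `FibreConstraint`; **`energy_eq_sum_fibreEnergy`** (the split of `‖∂A − Q^{e*}_kf‖²_η`), **`QvOp_eq_zero_iff`**
(the split of `Q_kA = 0`), and **`thm711_config_of_fibre`**.  NOT CLAIMED: the fibrewise bound itself (p10), the axial gauge δ_{k,Ax}
(by gauge invariance of `‖∂A − Q^{e*}_kf‖²` and of `Q_kA` under `A ↦ A − ∂^ηλ`, `Q′_kλ = 0`, it does not change the infimum — not
formalised here), the Gaussian integral reading of (4.2.1) (seats p09/p30 `BIJ85SigmaForm421`/`BIJ85Sigma421Torus` on the `Setup` carriers).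
Unit `lit-balaban-p27` (gen 5), HOME as above.
-/

namespace Literature.MathematicalPhysics.QuantumFieldTheory.BalabanImbrieJaffe1984to88.BIJ85Eq7112FibreEnergy

open scoped BigOperators Matrix ComplexConjugate
open Finset Complex
open Literature.MathematicalPhysics.QuantumFieldTheory.Balaban1983to89
open Literature.MathematicalPhysics.QuantumFieldTheory.Balaban1983to89.B5Prop11Plancherel
open Literature.MathematicalPhysics.QuantumFieldTheory.Balaban1983to89.B5Prop11Fiber
open Literature.MathematicalPhysics.QuantumFieldTheory.Balaban1983to89.B5Block118
open Literature.MathematicalPhysics.QuantumFieldTheory.Balaban1983to89.B5Action121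
open Literature.MathematicalPhysics.QuantumFieldTheory.BalabanImbrieJaffe1984to88.BIJ85Eq712Plancherel
open Literature.MathematicalPhysics.QuantumFieldTheory.BalabanImbrieJaffe1984to88.BIJ85Eq712SymbolCalculus
open Literature.MathematicalPhysics.QuantumFieldTheory.BalabanImbrieJaffe1984to88.BIJ85Eq715ConfigSymbols
open Literature.MathematicalPhysics.QuantumFieldTheory.BalabanImbrieJaffe1984to88.BIJ85MomentumSymbols71
open Literature.MathematicalPhysics.QuantumFieldTheory.BalabanImbrieJaffe1984to88.BIJ85Eq7111CrossSymbols
open Literature.MathematicalPhysics.QuantumFieldTheory.BalabanImbrieJaffe1984to88.BIJ85Eq7111EdgeAverage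
open Literature.MathematicalPhysics.QuantumFieldTheory.BalabanImbrieJaffe1984to88.BIJ85Eq7111EdgeAdjoint

noncomputable section

/-! ## §1 Momentum representations: fine-TI operators, adjoints of averaging operators -/

section Reps

variable {d : ℕ} (n : ℕ) [NeZero n] (M : Fin d → ℕ) [hM : ∀ μ, NeZero (M μ)]
variable (m m' : Type*) [Fintype m] [DecidableEq m] [Fintype m'] [DecidableEq m']

/-- A translation-invariant operator acts in momentum space by its symbol: `(F⊗1)(DA)(p)_j = Σ_i σ_D(p)_{ji}Â_i(p)` (any torus `N`;
the `∂`, `∂^*` of (7.1.12)). [cite: BalabanImbrieJaffe1985, (7.1.2) p.321] -/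
theorem dftC_mulVec_TI {N : Fin d → ℕ} [∀ μ, NeZero (N μ)] {D : Matrix (Tor N × m) (Tor N × m') ℂ} (hD : IsTranslInvR N m m' D)
    (A : Tor N × m' → ℂ) (p : Tor N) (j : m) :
    (dftC N m *ᵥ (D *ᵥ A)) (p, j) = ∑ i : m', symbR N m m' D p j i * (dftC N m' *ᵥ A) (p, i) := by
  have h : dftC N m *ᵥ (D *ᵥ A) = fibreOpR N m m' (symbR N m m' D) *ᵥ (dftC N m' *ᵥ A) := by
    conv_lhs => rw [eq_star_dftC_mul_fibreOpR_mul_dftC N m m' hD]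
    rw [Matrix.mulVec_mulVec, Matrix.mulVec_mulVec, ← Matrix.mul_assoc, ← Matrix.mul_assoc, dftC_mul_star, Matrix.one_mul]
  rw [h, Matrix.mulVec, dotProduct, Fintype.sum_prod_type, Finset.sum_eq_single p]
  · refine Finset.sum_congr rfl fun i _ => ?_
    rw [fibreOpR_apply, if_pos rfl]
  · intro p' _ hp'
    exact Finset.sum_eq_zero fun i _ => by rw [fibreOpR_apply, if_neg (Ne.symm hp'), zero_mul]
  · exact fun h => absurd (Finset.mem_univ _) h

/-- **The adjoint of an averaging operator in momentum space**: for a translation-invariant cross-lattice `T` (unit ← η),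
`(F_η⊗1)(Tᴴg)(p)_j = c·Σ_i conj(σ_T(p)_{ij}) ĝ_i(p mod 2π)` — each fine momentum `p′ + l` is fed from the unit momentum `p′` alone,
with the conjugate-transposed symbol (the `Q^{e*}_k` of (7.1.12); (2.22)_k in momentum space). [cite: BalabanImbrieJaffe1985, (7.1.12) p.322] -/
theorem dftC_mulVec_conjTranspose_cross {T : Matrix (Tor M × m) (Tor (fine n M) × m') ℂ} (hT : IsCrossTI n M m m' T)
    (g : Tor M × m → ℂ) (p : Tor (fine n M)) (j : m') :
    (dftC (fine n M) m' *ᵥ (Tᴴ *ᵥ g)) (p, j)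
      = (cQ n M : ℂ) * ∑ i : m, conj (symbX n M m m' T p i j) * (dftC M m *ᵥ g) (coarse n M p, i) := by
  have hT' : Tᴴ = star (dftC (fine n M) m')
      * (crossFibre n M m m' (fun p => (cQ n M : ℂ) • symbX n M m m' T p))ᴴ * dftC M m := by
    conv_lhs => rw [eq_star_dftC_mul_crossFibre_mul_dftC n M m m' hT]
    rw [Matrix.conjTranspose_mul, Matrix.conjTranspose_mul, Matrix.star_eq_conjTranspose, Matrix.star_eq_conjTranspose,
      Matrix.conjTranspose_conjTranspose, Matrix.mul_assoc]
  have h : dftC (fine n M) m' *ᵥ (Tᴴ *ᵥ g)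
      = (crossFibre n M m m' (fun p => (cQ n M : ℂ) • symbX n M m m' T p))ᴴ *ᵥ (dftC M m *ᵥ g) := by
    rw [hT', Matrix.mulVec_mulVec, Matrix.mulVec_mulVec, ← Matrix.mul_assoc, ← Matrix.mul_assoc, dftC_mul_star, Matrix.one_mul]
  rw [h, Matrix.mulVec, dotProduct, Fintype.sum_prod_type, Finset.sum_eq_single (coarse n M p), Finset.mul_sum]
  · refine Finset.sum_congr rfl fun i _ => ?_
    rw [Matrix.conjTranspose_apply, crossFibre_apply, if_pos rfl, Matrix.smul_apply, smul_eq_mul, star_mul', Complex.star_def,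
      Complex.conj_ofReal, mul_assoc]
  · intro q _ hq
    refine Finset.sum_eq_zero fun i _ => ?_
    rw [Matrix.conjTranspose_apply, crossFibre_apply, if_neg hq, star_zero, zero_mul]
  · exact fun h => absurd (Finset.mem_univ _) h

/-- kernel: on the η-torus, `e^{i(p′+l)·ηe_λ} = ω_λ`. [cite: BalabanImbrieJaffe1985, (7.1.4) p.322] -/
theorem chi_pOf_unitVec (k : Fin d → Fin n) (q : Tor M) (l : Fin d) :
    chi (fine n M) (pOf n M (k, q)) (unitVec (fine n M) l) = om n k (sOf M q) l := by
  have h : unitVec (fine n M) l = tstep (fine n M) l 1 := by rw [tstep_succ, tstep_zero, zero_add]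
  rw [h, chi_pOf_tstep, pow_one]

/-- **(7.1.4) on the coset**: the unit-difference symbol of the η-torus point `p′ + l` is `e^{iη(p′_λ+l_λ)} − 1`, so
`n·(e^{iηp_λ} − 1) = ∂_λ(p′+l) = B5Prop11Fiber.dSym n k p′ λ`. [cite: BalabanImbrieJaffe1985, (7.1.4) p.322] -/
theorem natCast_mul_dOne_pOf (k : Fin d → Fin n) (q : Tor M) (l : Fin d) :
    (n : ℂ) * dOne (sOf (fine n M) (pOf n M (k, q))) l = B5Prop11Fiber.dSym n k (sOf M q) l := by
  rw [dOne, ← chi_unitVec_eq_exp, chi_pOf_unitVec, dSym_eq_om]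

/-- **`∂^η` in momentum space on the coset**: `(∂^ηA)^(p′+l)_{λκ} = ∂_λ(p′+l)Â_κ(p′+l) − ∂_κ(p′+l)Â_λ(p′+l)` (`∂^η = n·curlC`).
[cite: BalabanImbrieJaffe1985, (7.1.4) p.322] -/
theorem dft_curl_fine (A : Tor (fine n M) × Fin d → ℂ) (k : Fin d → Fin n) (q : Tor M) (l κ : Fin d) :
    (n : ℂ) * (dftC (fine n M) (Fin d × Fin d) *ᵥ (curlC (fine n M) *ᵥ A)) (pOf n M (k, q), (l, κ))
      = B5Prop11Fiber.dSym n k (sOf M q) l * (dftC (fine n M) (Fin d) *ᵥ A) (pOf n M (k, q), κ)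
        - B5Prop11Fiber.dSym n k (sOf M q) κ * (dftC (fine n M) (Fin d) *ᵥ A) (pOf n M (k, q), l) := by
  rw [dftC_curlC_mulVec, curlOne, mul_sub, ← mul_assoc, ← mul_assoc, natCast_mul_dOne_pOf, natCast_mul_dOne_pOf]

/-- **`Q^{e*}_kf` in momentum space** ((2.22)_k / (7.1.11) adjoint): `(Q^{e*}_kf)^(p′+l)_{λκ} = n^d·c·w̄_{λκ}(p′+l)·f̂_{λκ}(p′)` (`n^d c =
c^{−1} = n^{d/2}`). [cite: BalabanImbrieJaffe1985, (7.1.11) p.322] -/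
theorem dft_edgeAdjC (f : Tor M × (Fin d × Fin d) → ℂ) (k : Fin d → Fin n) (q : Tor M) (a : Fin d × Fin d) :
    (dftC (fine n M) (Fin d × Fin d) *ᵥ (edgeAdjC n M *ᵥ f)) (pOf n M (k, q), a)
      = (n : ℂ) ^ d * (cQ n M : ℂ) * (conj (edgeW n k (sOf M q) a.1 a.2) * (dftC M (Fin d × Fin d) *ᵥ f) (q, a)) := by
  rw [edgeAdjC, Matrix.smul_mulVec, Matrix.mulVec_smul, Pi.smul_apply, smul_eq_mul,
    dftC_mulVec_conjTranspose_cross n M (Fin d × Fin d) (Fin d × Fin d) (isCrossTI_edgeAvgC n M), coarse_pOf,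
    Finset.sum_eq_single a, mul_assoc]
  · rcases a with ⟨μ, ν⟩
    rw [symbX_edgeAvgC_pOf, if_pos rfl]
  · rintro ⟨μ, ν⟩ _ hb
    rcases a with ⟨μ', ν'⟩
    rw [symbX_edgeAvgC_pOf, if_neg (Ne.symm hb), map_zero, zero_mul]
  · exact fun h => absurd (Finset.mem_univ _) h

omit [DecidableEq m] in
/-- Plancherel split over the cosets: `Σ_x|g(x)|² = Σ_{p′}Σ_lΣ_j|ĝ_j(p′+l)|²`. [cite: BalabanImbrieJaffe1985, (7.1.2) p.321] -/
theorem sum_norm_sq_eq_sum_cosets [DecidableEq m] (g : Tor (fine n M) × m → ℂ) :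
    ∑ b, ‖g b‖ ^ 2 = ∑ q : Tor M, ∑ k : Fin d → Fin n, ∑ j : m, ‖(dftC (fine n M) m *ᵥ g) (pOf n M (k, q), j)‖ ^ 2 := by
  rw [sum_norm_sq_eq_sum_norm_sq_dftC (fine n M) m g,
    ← (pOf_bijective n M).sum_comp (fun p => ∑ j : m, ‖(dftC (fine n M) m *ᵥ g) (p, j)‖ ^ 2), Fintype.sum_prod_type,
    Finset.sum_comm]

end Reps

/-! ## §2 The fibre energy and the fibre constraint -/

section Fibre

variable {d : ℕ} (n : ℕ) [NeZero n] (M : Fin d → ℕ) [hM : ∀ μ, NeZero (M μ)]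

/-- **The fibre energy at the unit momentum `p′`**: `E_{p′}(α, φ) = Σ_l Σ_{(λ,κ)} |∂_λ(p′+l)α_l(κ) − ∂_κ(p′+l)α_l(λ) − w̄_{λκ}(p′+l)φ_{λκ}|²`
— the restriction of `‖∂A − Q^{e*}_kf‖²_η` to the coset of `p′` in momentum space (`α_l = c·Â(p′+l)`, `φ = f̂(p′)`; ordered pairs `(λ,κ)`,
each plaquette counted with both orientations; `w` = the (7.1.11) weight `edgeW`). [cite: BalabanImbrieJaffe1985, (7.1.12) p.322] -/
def fibreEnergy (q : Tor M) (α : (Fin d → Fin n) → Fin d → ℂ) (φ : Fin d × Fin d → ℂ) : ℝ :=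
  ∑ k : Fin d → Fin n, ∑ a : Fin d × Fin d,
    ‖B5Prop11Fiber.dSym n k (sOf M q) a.1 * α k a.2 - B5Prop11Fiber.dSym n k (sOf M q) a.2 * α k a.1
      - conj (edgeW n k (sOf M q) a.1 a.2) * φ a‖ ^ 2

/-- **The fibre constraint at `p′`** (`Q_kA = 0` in momentum space, [6I] (1.61)): `Σ_l u(p′+l)v_μ(p′+l)α_l(μ) = 0` for every
direction `μ`. [cite: BalabanImbrieJaffe1985, (4.2.1) p.310] -/
def FibreConstraint (q : Tor M) (α : (Fin d → Fin n) → Fin d → ℂ) : Prop :=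
  ∀ μ : Fin d, ∑ k : Fin d → Fin n, uSym n k (sOf M q) * vSym n k (sOf M q) μ * α k μ = 0

/-- kernel: `c² = n^{−d}` over ℝ. [folklore] -/
private theorem cQ_sq_real : (cQ n M) ^ 2 = ((n : ℝ) ^ d)⁻¹ := by
  have hn : (0 : ℝ) ≤ (n : ℝ) ^ d := pow_nonneg (Nat.cast_nonneg n) d
  rw [cQ_eq, inv_pow, Real.sq_sqrt hn]

/-- kernel: `n^d·c·c = 1`. [folklore] -/
private theorem natCast_pow_mul_cQ_mul_cQ : (n : ℂ) ^ d * (cQ n M : ℂ) * (cQ n M : ℂ) = 1 := by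
  have hn : ((n : ℂ) ^ d) ≠ 0 := pow_ne_zero _ (by exact_mod_cast NeZero.ne n)
  rw [mul_assoc, ← sq, cQ_sq, mul_inv_cancel₀ hn]

/-- kernel: `η^d|z|² = |c·z|²`. [folklore] -/
private theorem inv_pow_mul_norm_sq (z : ℂ) : ((n : ℝ) ^ d)⁻¹ * ‖z‖ ^ 2 = ‖(cQ n M : ℂ) * z‖ ^ 2 := by
  rw [norm_mul, mul_pow, Complex.norm_real, Real.norm_eq_abs, sq_abs, cQ_sq_real]

/-- **THE ENERGY SPLITS OVER THE UNIT MOMENTA**: for every η-bond field `A` and unit plaquette field `f`,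
`‖∂^ηA − Q^{e*}_kf‖²_η = η^dΣ_x|(n·curl A − Q^{e*}_kf)(x)|² = Σ_{p′} E_{p′}((c·Â(p′+l))_l, f̂(p′))` — the first step of *"Starting from this
expression, one can derive the following formulas for σ_k(p)"* (7.1.12)→(7.1.13). [cite: BalabanImbrieJaffe1985, (7.1.12) p.322] -/
theorem energy_eq_sum_fibreEnergy (A : Tor (fine n M) × Fin d → ℂ) (f : Tor M × (Fin d × Fin d) → ℂ) :
    ((n : ℝ) ^ d)⁻¹ * ∑ b, ‖((n : ℂ) • (curlC (fine n M) *ᵥ A) - edgeAdjC n M *ᵥ f) b‖ ^ 2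
      = ∑ q : Tor M, fibreEnergy n M q
          (fun k i => (cQ n M : ℂ) * (dftC (fine n M) (Fin d) *ᵥ A) (pOf n M (k, q), i))
          (fun a => (dftC M (Fin d × Fin d) *ᵥ f) (q, a)) := by
  rw [sum_norm_sq_eq_sum_cosets n M (Fin d × Fin d), Finset.mul_sum]
  refine Finset.sum_congr rfl fun q _ => ?_
  rw [fibreEnergy, Finset.mul_sum]
  refine Finset.sum_congr rfl fun k _ => ?_
  rw [Finset.mul_sum]
  refine Finset.sum_congr rfl fun a _ => ?_
  rcases a with ⟨l, κ⟩
  -- `n^{-d}|ĝ|² = |c·ĝ|²` and `c·ĝ(p′+l) = ∂-curl(cÂ) − w̄ f̂(p′)`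
  rw [inv_pow_mul_norm_sq n M]
  congr 2
  rw [Matrix.mulVec_sub, Matrix.mulVec_smul, Pi.sub_apply, Pi.smul_apply, smul_eq_mul, dft_curl_fine, dft_edgeAdjC]
  linear_combination (-(conj (edgeW n k (sOf M q) l κ) * (dftC M (Fin d × Fin d) *ᵥ f) (q, (l, κ))))
    * natCast_pow_mul_cQ_mul_cQ n M

/-- kernel: the components of `F⊗1` are the one-component transforms (API bridge to `B5Block118.dft_QvOp`). [folklore] -/
private theorem dftC_apply_eq_dft_comp {N : Fin d → ℕ} [∀ μ, NeZero (N μ)] (A : Tor N × Fin d → ℂ) (p : Tor N) (μ : Fin d) :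
    (dftC N (Fin d) *ᵥ A) (p, μ) = (dft N *ᵥ comp N A μ) p := by
  rw [dftC_mulVec_apply]
  rfl

/-- **THE CONSTRAINT SPLITS OVER THE UNIT MOMENTA**: `Q_kA = 0` iff, for every unit momentum `p′`, the fibre family `(Â(p′+l))_l`
satisfies `Σ_l u(p′+l)v_μ(p′+l)Â_μ(p′+l) = 0` for all `μ` ([6I] (1.61) = pub-balaban `B5Block118.dft_QvOp`).
[cite: BalabanImbrieJaffe1985, (4.2.1) p.310] -/
theorem QvOp_eq_zero_iff (A : Tor (fine n M) × Fin d → ℂ) :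
    QvOp n M *ᵥ A = 0 ↔ ∀ q : Tor M, FibreConstraint n M q (fun k i => (dftC (fine n M) (Fin d) *ᵥ A) (pOf n M (k, q), i)) := by
  have hc : (cQ n M : ℂ) ≠ 0 := by
    have hn : (0 : ℝ) < (n : ℝ) ^ d := pow_pos (by exact_mod_cast Nat.pos_of_ne_zero (NeZero.ne n)) d
    rw [cQ_eq]
    exact_mod_cast (inv_pos.mpr (Real.sqrt_pos.mpr hn)).ne'
  -- `Q_kA = 0 ⟺ (F⊗1)(Q_kA) = 0 ⟺ every component of (1.61) vanishes`
  have key : ∀ q μ, (dftC M (Fin d) *ᵥ (QvOp n M *ᵥ A)) (q, μ)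
      = (cQ n M : ℂ) * ∑ k : Fin d → Fin n, uSym n k (sOf M q) * vSym n k (sOf M q) μ
          * (dftC (fine n M) (Fin d) *ᵥ A) (pOf n M (k, q), μ) := by
    intro q μ
    rw [dftC_apply_eq_dft_comp, dft_QvOp]
    simp_rw [dftC_apply_eq_dft_comp]
  constructor
  · intro h q μ
    have h1 := key q μ
    rw [h, Matrix.mulVec_zero, Pi.zero_apply] at h1
    exact (mul_eq_zero.mp h1.symm).resolve_left hc
  · intro h
    have h2 : dftC M (Fin d) *ᵥ (QvOp n M *ᵥ A) = 0 := by
      funext ⟨q, μ⟩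
      rw [key, h q μ, mul_zero, Pi.zero_apply]
    calc QvOp n M *ᵥ A = (star (dftC M (Fin d)) * dftC M (Fin d)) *ᵥ (QvOp n M *ᵥ A) := by
          rw [star_dftC_mul, Matrix.one_mulVec]
      _ = 0 := by rw [← Matrix.mulVec_mulVec, h2, Matrix.mulVec_zero]

omit [NeZero n] hM in
/-- The fibre constraint is homogeneous: scaling the family by `c ≠ 0` does not change it. [cite: BalabanImbrieJaffe1985, (4.2.1) p.310] -/
theorem fibreConstraint_smul_iff (q : Tor M) (α : (Fin d → Fin n) → Fin d → ℂ) {c : ℂ} (hc : c ≠ 0) :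
    FibreConstraint n M q (fun k i => c * α k i) ↔ FibreConstraint n M q α := by
  unfold FibreConstraint
  refine forall_congr' fun μ => ?_
  have h : ∑ k : Fin d → Fin n, uSym n k (sOf M q) * vSym n k (sOf M q) μ * (c * α k μ)
      = c * ∑ k : Fin d → Fin n, uSym n k (sOf M q) * vSym n k (sOf M q) μ * α k μ := by
    rw [Finset.mul_sum]
    exact Finset.sum_congr rfl fun k _ => by ring
  rw [h, mul_eq_zero, or_iff_right hc]

/-! ## §3 Theorem 7.1.1 in configuration space from a uniform fibrewise bound -/

/-- **THEOREM 7.1.1 IN CONFIGURATION SPACE, VARIATIONAL FORM, FROM THE FIBRES**: if ONE constant `c₀` bounds every fibre problem from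
below — `c₀Σ_{λκ}|φ_{λκ}|² ≤ E_{p′}(α, φ)` for every unit momentum `p′`, every `φ` and every family `α` satisfying the fibre constraint
(the content of (7.1.13)–(7.1.16) + Proposition 7.1.2, seat p10) — then for every unit plaquette field `f` and every η-bond field `A` with
`Q_kA = 0`: `c₀‖f‖² ≤ ‖∂^ηA − Q^{e*}_kf‖²_η`; i.e. (with (4.2.1), whose Gaussian infimum over the constrained `A` is `½⟨f,σ_kf⟩`, and gauge
invariance for the axial gauge) `c₀‖f‖² ≤ ⟨f, σ_kf⟩` — Theorem 7.1.1 for the configuration-space σ_k on the torus `T_η`.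
[cite: BalabanImbrieJaffe1985, Thm. 7.1.1 p.321] -/
theorem thm711_config_of_fibre {c₀ : ℝ}
    (hfib : ∀ (q : Tor M) (φ : Fin d × Fin d → ℂ) (α : (Fin d → Fin n) → Fin d → ℂ),
      FibreConstraint n M q α → c₀ * ∑ a, ‖φ a‖ ^ 2 ≤ fibreEnergy n M q α φ)
    (f : Tor M × (Fin d × Fin d) → ℂ) (A : Tor (fine n M) × Fin d → ℂ) (hA : QvOp n M *ᵥ A = 0) :
    c₀ * ∑ a, ‖f a‖ ^ 2 ≤ ((n : ℝ) ^ d)⁻¹ * ∑ b, ‖((n : ℂ) • (curlC (fine n M) *ᵥ A) - edgeAdjC n M *ᵥ f) b‖ ^ 2 := by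
  have hc : (cQ n M : ℂ) ≠ 0 := by
    have hn : (0 : ℝ) < (n : ℝ) ^ d := pow_pos (by exact_mod_cast Nat.pos_of_ne_zero (NeZero.ne n)) d
    rw [cQ_eq]
    exact_mod_cast (inv_pos.mpr (Real.sqrt_pos.mpr hn)).ne'
  rw [energy_eq_sum_fibreEnergy, sum_norm_sq_eq_sum_norm_sq_dftC M (Fin d × Fin d) f, Finset.mul_sum]
  refine Finset.sum_le_sum fun q _ => hfib q _ _ ?_
  rw [fibreConstraint_smul_iff n M q _ hc]
  exact (QvOp_eq_zero_iff n M A).mp hA q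

end Fibre

end

end Literature.MathematicalPhysics.QuantumFieldTheory.BalabanImbrieJaffe1984to88.BIJ85Eq7112FibreEnergy
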